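import Summits.HodgeConjecture.HodgeConjecture.Theorems.MarkmanPartnerTransportK3Sq2TypeHodgeOfRMThird
import Summits.HodgeConjecture.HodgeConjecture.Theorems.MarkmanPartnerTransportIsometrySpannedThirdSelfAdjointScalar

/-!
# Route MarkmanPartnerTransport · target `K3Sq2TypeHodge` (stmt-HodgeConjecture-19649) — THE RESIDUE, BY RANK:
# the target BY NAME from (a) the real-multiplication third of K3 squares (`ρ(X) ≥ 4`) and (b) HC⁴ for the
# low-Picard fourfolds with a non-scalar self-adjoint Hodge endomorphism (`ρ(X) ≤ 3`, `E₀ ≠ ℚ`)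

What the route's target still needs after gens 0–6, in one statement concluding `K3Sq2TypeHodge` BY NAME:

* at `ρ(X) ≥ 4` a K3 partner exists and transports (`hodgeConjectureFor_of_rmThird_of_four_le`, seven facts),
  leaving the REAL-MULTIPLICATION third of K3 squares: the cycle-induced-sector clause for projective K3
  surfaces `S` with `3 ≤ ρ(S) ≤ 16`, `End_Hdg T(S)` neither `ℚ` nor CM (hypothesis `hRM`, verbatim from
  `…K3Sq2TypeHodgeOfRMThird`);
* at `ρ(X) ≤ 3` (no partner) the partner-free theorem `hodgeConjectureFor_of_selfAdjointEndomorphisms_scalar`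
  (three facts) settles every `X` whose `q`-self-adjoint rational Hodge endomorphisms of `T(X)` are rational
  scalars (`E₀ = ℚ`), leaving the fourfolds with `ρ(X) ≤ 3` carrying a NON-scalar such endomorphism
  (`E₀ ≠ ℚ`: real multiplication, or CM by a field of degree `≥ 4`) — hypothesis `hres`.

* `k3Sq2TypeHodge_of_rmThird_of_lowPicardNonScalar` — (nine named facts) → `hRM` → `hres` → `K3Sq2TypeHodge`.

CONDITIONAL; credits nothing; both brackets are open problems (van Geemen 2008 RM; no partner below rank 4).
No definition, no sorry. References: E. Markman, Compos. Math. 160 (2024); N. Buskin, J. reine angew. Math.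
755 (2019); B. van Geemen, Michigan Math. J. 56 (2008); Yu. Zarhin, J. reine angew. Math. 341 (1983) Thm. 1.5.1.
-/

noncomputable section

set_option linter.dupNamespace false

open Module CategoryTheory MonoidalCategory
open Literature.AlgebraicTopology.SingularHomology
open Literature.AlgebraicGeometry Literature.AlgebraicGeometry.Motives Literature.AlgebraicGeometry.HodgeTheory
open Literature.AlgebraicGeometry.Hyperkaehler Literature.AlgebraicGeometry.Surfaces
open Literature.AlgebraicGeometry.HilbertScheme
open Summit.HodgeConjecture.HodgeConjecture.Theorems.NikulinTwinTransport
open Summit.HodgeConjecture.HodgeConjecture.Theorems.MarkmanPartnerTransport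

namespace Summit.HodgeConjecture.HodgeConjecture.Theorems.MarkmanPartnerTransport.PartnerLattice

/-- `MarkedK3Sq[X, φ, P, z]`: VERBATIM the `let MarkedK3Sq := …` binder of the route declarations of
MarkmanPartnerTransport (clauses (m1)–(m6)). Local notation only. -/
local notation3 (prettyPrint := false) "MarkedK3Sq[" X ", " φ ", " P ", " z "]" =>
  (((IsIntegralClass P ∧ ∀ Q : complexBetti X (2 * 4), IsIntegralClass Q → ∃ n : ℤ, Q = n • P) ∧
    (∀ c : complexBetti X 2, IsIntegralClass c ↔ ∃ v : K3HilbertIndex → ℤ, φ c = fun i => (v i : ℂ)) ∧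
    (∀ a : complexBetti X 2, cupPowTwo a 4 = ((3 : ℂ) * (k3HilbertForm 2 (φ a) (φ a)) ^ 2) • P) ∧
    (IsOfHodgeType 4 X 2 2 0 (LinearEquiv.symm φ z) ∧
      ∀ τ : complexBetti X 2, IsOfHodgeType 4 X 2 2 0 τ → ∃ t : ℂ, τ = t • LinearEquiv.symm φ z) ∧
    (∀ c : complexBetti X 2, IsOfHodgeType 4 X 2 1 1 c ↔
      (k3HilbertForm 2 (φ c) z = 0 ∧ k3HilbertForm 2 (φ c) (star z) = 0)) ∧
    (k3HilbertForm 2 z z = 0 ∧ 0 < (k3HilbertForm 2 (star z) z).re)))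

/-- `Corr[μ, hS ; γ, y] = pr₁_*(pr₂^* y ∪ γ)` on `H²(S(ℂ); ℂ)`. Local notation only. -/
local notation3 (prettyPrint := false) "Corr[" μ ", " hS " ; " γ ", " y "]" =>
  complexGysin μ (IsSmoothProjective.tensor_holds hS hS) hS
    (SemiCartesianMonoidalCategory.fst _ _) (rfl : 2 * 1 + 2 * 2 + 2 * 2 = 2 * 1 + 2 * (2 + 2))
    (cupProduct (rfl : 2 * 1 + 2 * 2 = 2 * 1 + 2 * 2)
      (complexBetti.map (SemiCartesianMonoidalCategory.snd _ _) (2 * 1) y) γ)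

/-- `hQXsa[X, φ]`: every `q`-SELF-ADJOINT rational Hodge endomorphism of `H²(X)` killing `N¹(X)` with
`q`-transcendental image is a rational scalar on `T(X)` (`E₀ = ℚ`). Local notation only. -/
local notation3 (prettyPrint := false) "hQXsa[" X ", " φ "]" =>
  ∀ f : complexBetti X 2 →ₗ[ℂ] complexBetti X 2,
    (∀ y, IsRationalClass y → IsRationalClass (f y)) →
    (∀ (i j : ℕ) y, IsOfHodgeType 4 X 2 i j y → IsOfHodgeType 4 X 2 i j (f y)) →
    (∀ d : complexBetti X 2, d ∈ algebraicClasses X 1 → f d = 0) →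
    (∀ y : complexBetti X 2, ∀ d : complexBetti X 2, d ∈ algebraicClasses X 1 →
      k3HilbertForm 2 (φ (f y)) (φ d) = 0) →
    (∀ y w : complexBetti X 2, k3HilbertForm 2 (φ (f y)) (φ w) = k3HilbertForm 2 (φ y) (φ (f w))) →
    ∃ a : ℚ, ∀ y : complexBetti X 2,
      (∀ d : complexBetti X 2, d ∈ algebraicClasses X 1 → k3HilbertForm 2 (φ y) (φ d) = 0) →
      f y = (a : ℂ) • y

/-- **The route's target from its two open residues** (module docstring): the real-multiplication third of
K3 squares (`ρ(X) ≥ 4`, via partner existence and transport) and HC⁴ for marked fourfolds with `ρ(X) ≤ 3`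
admitting a non-scalar `q`-self-adjoint rational Hodge endomorphism of `T(X)`; modulo nine published facts.
[cite: Markman2024, §1.1 Thm. 1.1 and Thm. 1.4] [cite: Zarhin1983HodgeGroupsK3, Thm. 1.5.1]
[cite: Vangeemen2008, Lemma 3.2] [cite: Buskin2019, Thm. 1.1] -/
theorem k3Sq2TypeHodge_of_rmThird_of_lowPicardNonScalar (hP : Huybrechts_K3_periodSurjective_projective)
    (hB : Beauville1983_hilbertSquare_markedIncidence)
    (hρ : Beauville1983_hilbertSquare_blowupDiagonal_surjection)
    (hMk : Markman2024_rationalHodgeIsometry_lift_algebraic_marked)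
    (hcup : Voisin2003_cupProduct_algebraicClasses) (hBu : Buskin2019_hodgeIsometry_algebraic)
    (hmark : Huybrechts_K3_marking_exists) (hV : VerbitskyGuan_cohomology_K3HilbertSquareType)
    (hO : OGrady2008_dualBBFClass_algebraic)
    (hRM : ∀ (S : SchemeOver ℂ) (hS : IsK3Surface S), ¬ HasComplexMultiplication S →
      3 ≤ Module.finrank ℂ ↥(algebraicClasses S 1) → Module.finrank ℂ ↥(algebraicClasses S 1) ≤ 16 →
      (¬ ∀ (f : complexBetti S (2 * 1) →ₗ[ℂ] complexBetti S (2 * 1)),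
        (∀ y, IsRationalClass y → IsRationalClass (f y)) →
        (∀ (i j : ℕ) y, IsOfHodgeType 2 S (2 * 1) i j y → IsOfHodgeType 2 S (2 * 1) i j (f y)) →
        (∀ d ∈ algebraicClasses S 1, f d = 0) →
        (∀ y : complexBetti S (2 * 1), ∀ d ∈ algebraicClasses S 1,
          cupProduct (rfl : 2 * 1 + 2 * 1 = 2 * 2) (f y) d = 0) →
        ∃ a : ℚ, ∀ y : complexBetti S (2 * 1),
          (∀ d ∈ algebraicClasses S 1, cupProduct (rfl : 2 * 1 + 2 * 1 = 2 * 2) y d = 0) →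
            f y = (a : ℂ) • y) →
      ∀ (f : complexBetti S (2 * 1) →ₗ[ℂ] complexBetti S (2 * 1)),
        (∀ y, IsRationalClass y → IsRationalClass (f y)) →
        (∀ (i j : ℕ) y, IsOfHodgeType 2 S (2 * 1) i j y → IsOfHodgeType 2 S (2 * 1) i j (f y)) →
        (∀ d ∈ algebraicClasses S 1, f d = 0) →
        (∀ y : complexBetti S (2 * 1), ∀ d ∈ algebraicClasses S 1,
          cupProduct (rfl : 2 * 1 + 2 * 1 = 2 * 2) (f y) d = 0) →
        ∃ g : complexBetti S (2 * 1) →ₗ[ℂ] complexBetti S (2 * 1),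
          (∀ d ∈ algebraicClasses S 1, g d ∈ algebraicClasses S 1) ∧
          (∃ γ ∈ algebraicClasses (S ⊗ S) 2, ∀ y : complexBetti S (2 * 1),
            g y = Corr[complexOrientationFamily, hS.isSmoothProjective ; γ, y]) ∧
          ∀ y : complexBetti S (2 * 1),
            (∀ d ∈ algebraicClasses S 1, cupProduct (rfl : 2 * 1 + 2 * 1 = 2 * 2) y d = 0) →
              f y = g y)
    (hres : ∀ (X : SchemeOver ℂ), IsSmoothProjective 4 X → IsOfK3HilbertSquareType X →
      ∀ (φ : complexBetti X 2 ≃ₗ[ℂ] (K3HilbertIndex → ℂ)) (P : complexBetti X (2 * 4)) (z : K3HilbertIndex → ℂ),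
      MarkedK3Sq[X, φ, P, z] → Module.finrank ℂ ↥(algebraicClasses X 1) ≤ 3 →
      ∀ f : complexBetti X 2 →ₗ[ℂ] complexBetti X 2,
        (∀ y, IsRationalClass y → IsRationalClass (f y)) →
        (∀ (i j : ℕ) y, IsOfHodgeType 4 X 2 i j y → IsOfHodgeType 4 X 2 i j (f y)) →
        (∀ d : complexBetti X 2, d ∈ algebraicClasses X 1 → f d = 0) →
        (∀ y : complexBetti X 2, ∀ d : complexBetti X 2, d ∈ algebraicClasses X 1 →
          k3HilbertForm 2 (φ (f y)) (φ d) = 0) →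
        (∀ y w : complexBetti X 2, k3HilbertForm 2 (φ (f y)) (φ w) = k3HilbertForm 2 (φ y) (φ (f w))) →
        (∀ a : ℚ, ∃ y : complexBetti X 2,
          (∀ d : complexBetti X 2, d ∈ algebraicClasses X 1 → k3HilbertForm 2 (φ y) (φ d) = 0) ∧
            f y ≠ (a : ℂ) • y) →
        HodgeConjectureFor 4 X) :
    Summit.HodgeConjecture.HodgeConjecture.Theses.MarkmanPartnerTransport.K3Sq2TypeHodge := by
  delta Summit.HodgeConjecture.HodgeConjecture.Theses.MarkmanPartnerTransport.K3Sq2TypeHodge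
  intro _ X hX hK φ P z hM
  by_cases h4 : 4 ≤ Module.finrank ℂ (algebraicClasses X 1)
  · exact hodgeConjectureFor_of_rmThird_of_four_le hP hB hρ hMk hcup hBu hmark hRM hX hK hM h4
  · by_cases h : hQXsa[X, φ]
    · exact hodgeConjectureFor_of_selfAdjointEndomorphisms_scalar hV hO hcup hX hK hM h
    · push Not at h
      obtain ⟨f, h1, h2, h3, h5, h6, hne⟩ := h
      exact hres X hX hK φ P z hM (by omega) f h1 h2 h3 h5 h6 hne

end Summit.HodgeConjecture.HodgeConjecture.Theorems.MarkmanPartnerTransport.PartnerLattice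

end
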